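import Literature.AnabelianGeometry.EtaleTheta.Prop42Sub
import Literature.AnabelianGeometry.EtaleTheta.Discharge.Sec4Model
import HarnessLib

/-!
# [EtTh] Prop. 4.2 (iii): the sub-node L04 `RootSquares` («translating into the language of Frobenioids»)
# DISCHARGED modulo the [FrdI] Thm. 5.2 (ii) dictionary

Mochizuki, *The étale theta function …*, Publ. RIMS **45** (2009), §4, Prop. 4.2 (iii), statement PDF p.88
L55 – p.89 L1, proof p.89 L76 – p.90 L11 [cite: MochizukiEtTh2009, Prop 4.2 p.88]. PROOF-ONLY companion
(abc-iut cell, writer abc-iut-w5-d134) of the sub-DAG statements file `Prop42Sub.lean`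
(`plan/L2/SUBDAG-EtTh-Prop42.md`, row EtTh:Prop4.2(iii)/L04) over abc-iut-L2-t3's `BiKummerSetting` /
`NthRoot` / `FractionPair`; nothing there is edited, no definition and no named fact is introduced here.

ROW L04 (p.90 L6–9: «the existence of a pair of commutative diagrams as in the statement of assertion (iii)
follows by translating the above "scheme-theoretic observations" into the language of Frobenioids — cf.
[FrdI], Definition 1.3, (iii), (d)»): given the base-Frobenius-type isometry `α : A_N → A_⊙` of Frobenius
degree `N` with pull-back part `α'`, an `N`-th root `g` of `((α')^birat)^* f` and a fraction-pair
`(s'_N, s''_N) : A_N → B_N` for `g` with `N · Div(s'_N) = (α')^* Div(s')`, `N · Div(s''_N) = (α')^* Div(s'')`,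
THE isometry `β : B_N → B` of Frobenius degree `N` closing BOTH squares exists. PROOF, for EVERY setting
`S` modulo the [FrdI] Thm. 5.2 (ii) facts `B` group-like and the birational DICTIONARY
`toB : O^×(A^birat) → B(A_D)^×` computing fractions and compatible with the transport `pullFrac` (identity
at abc-iut-L2-t9's `mkOfModel`/`pullFracModel`): in the model Frobenioid ([FrdI] Thm. 5.2 (i)) write
`β := (N, Base(s'_N)⁻¹ ∘ Base(α) ∘ Base(s'), 0, u_β)` with
`u_β := (Base(s'_N)⁻¹)^*(u_{s'∘α} · u_{s'_N}^{-N})` — relation (d) for `β` is relation (d) for `s' ∘ α`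
transported along `Base(s'_N)⁻¹` minus `N` times relation (d) for `s'_N` (`rootSquares_rel`); the
`s'`-square then holds by construction and the `s''`-square holds EXACTLY because `s'·(s'')⁻¹ = f`,
`s'_N·(s''_N)⁻¹ = g` and `g^N = ((α')^birat)^* f` (`rootSquares_of`). Model instance:
`BiKummerSetting.rootSquares_mkOfModel`. Typed ≠ proved for the other rows; nothing here takes a side on
[IUTchIII] Cor. 3.12.
-/

namespace Literature.AnabelianGeometry.EtaleTheta

open CategoryTheory Opposite Literature.AlgebraicGeometry.Frobenioids
open Literature.AlgebraicGeometry.Frobenioids.PreFrobenioid (pull_inv_pull_eq pull_pull_inv_eq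
  pull_injective pullGp_of' pullGp_inv_pullGp pullGp_pullGp_inv pullGp_injective)

universe u₀ v₀ u v w

variable {K : Type u₀} [Field K]

namespace BiKummerSetting

variable {X : SemiGraphs.TemperedArithmeticGroup.{u₀} K} {D₀ : Type u₀} [Category.{v₀} D₀]
  {V : FrdIMonoidStub.{w}} {T : RealifiedDivisorMonoids (D₀ := D₀) V} {D : Type u} [Category.{v} D]
  {VD : FrdICatStub.{u, v, w} D} (S : BiKummerSetting X T D VD)

namespace Prop42Sub

variable (pullFrac : ∀ {A A' : S.C} (_ : A' ⟶ A), S.biratUnits A → S.biratUnits A')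

/-- **Relation (d) for `β`.** In the model Frobenioid, for a pre-step `s : A' → B_N` and a morphism
`ψ : A' → B` of Frobenius degree `N` with `Div(ψ) = N · Div(s)`, the data
`(N, Base(s)⁻¹ ∘ Base(ψ), 0, (Base(s)⁻¹)^*(u_ψ · u_s^{-N}))` satisfy relation (d) of [FrdI] Thm. 5.2 (i) at
`B_N` — i.e. define a morphism `β : B_N → B` (it is the unique one with `β ∘ s = ψ`).
[cite: MochizukiFrdI2008, Thm. 5.2(i) p.100] -/
theorem rootSquares_rel {A' BN B : S.C} (s : A' ⟶ BN) (ψ : A' ⟶ B) [IsIso (ModelFrobenioid.baseMap s)]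
    (hs : ModelFrobenioid.degFr s = 1) {N : ℕ+} (hψN : ModelFrobenioid.degFr ψ = N)
    (hdiv : ModelFrobenioid.div ψ = ModelFrobenioid.div s ^ (N : ℕ))
    (us : (S.tf.ratFnFunctor.obj (op A'.base))ˣ) (hus : (us : S.tf.ratFnFunctor.obj (op A'.base)) =
      ModelFrobenioid.unit s) :
    BN.cls ^ ((N : ℕ+) : ℕ) * Algebra.GrothendieckGroup.of (1 : S.tf.divisorMonoid.obj (op BN.base)) =
      pullGp S.tf.divisorMonoid (inv (ModelFrobenioid.baseMap s) ≫ ModelFrobenioid.baseMap ψ) B.cls *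
        divB S.tf.divisorMonoid S.tf.ratFnFunctor S.tf.divBNatTrans (op BN.base)
          (pull S.tf.ratFnFunctor (inv (ModelFrobenioid.baseMap s))
            (ModelFrobenioid.unit ψ * ↑(us⁻¹ ^ (N : ℕ)))) := by
  have RQ := ModelFrobenioid.rel s
  rw [hs, PNat.one_coe, pow_one, ← hus] at RQ
  have Rψ := ModelFrobenioid.rel ψ
  rw [hψN, hdiv] at Rψ
  -- `pullGp (Base s) BN.cls = A'.cls * of(Div s) * Div_B(u_s)⁻¹`
  have hP : pullGp S.tf.divisorMonoid (ModelFrobenioid.baseMap s) BN.cls =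
      A'.cls * Algebra.GrothendieckGroup.of (ModelFrobenioid.div s) *
        (divB S.tf.divisorMonoid S.tf.ratFnFunctor S.tf.divBNatTrans (op A'.base)
          (us : S.tf.ratFnFunctor.obj (op A'.base)))⁻¹ :=
    eq_mul_inv_of_mul_eq RQ.symm
  -- `Div_B(u_s^{-N}) = Div_B(u_s)^{-N}`
  have hdivB : divB S.tf.divisorMonoid S.tf.ratFnFunctor S.tf.divBNatTrans (op A'.base)
      (↑(us⁻¹ ^ (N : ℕ)) : S.tf.ratFnFunctor.obj (op A'.base)) =
      (divB S.tf.divisorMonoid S.tf.ratFnFunctor S.tf.divBNatTrans (op A'.base)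
        (us : S.tf.ratFnFunctor.obj (op A'.base)))⁻¹ ^ (N : ℕ) := by
    rw [Units.val_pow_eq_pow_val, map_pow]
    congr 1
    apply eq_inv_of_mul_eq_one_left
    rw [← map_mul, Units.inv_mul, map_one]
  -- transport the goal along the isomorphism `Base(s)`
  rw [map_one, mul_one]
  apply pullGp_injective (Φ := S.tf.divisorMonoid) (ModelFrobenioid.baseMap s)
  rw [map_pow, hP, map_mul, ← pullGp_comp, IsIso.hom_inv_id_assoc, ModelFrobenioid.pullGp_divB_pull,
    pull_pull_inv_eq, map_mul, ← mul_assoc, ← Rψ, hdivB, map_pow, mul_pow, mul_pow]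

/-- **(iii)/L04 `RootSquares` DISCHARGED modulo the [FrdI] Thm. 5.2 (ii) facts** `B` group-like and the
birational dictionary `toB` (fractions: `toB(s'·(s'')⁻¹) · u_{s''} = u_{s'}`; transport:
`toB(((φ)^birat)^* x) = Base(φ)^* toB(x)`). The isometry `β` of Frobenius degree `N` is
`(N, Base(s'_N)⁻¹ ∘ Base(α) ∘ Base(s'), 0, (Base(s'_N)⁻¹)^*(u_{s'∘α} · u_{s'_N}^{-N}))`; `s' ∘ α = β ∘ s'_N` by
construction and `s'' ∘ α = β ∘ s''_N` because `s'·(s'')⁻¹ = f`, `s'_N·(s''_N)⁻¹ = g`, `g^N = ((α')^birat)^* f`.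
[cite: MochizukiEtTh2009, Prop 4.2 p.90] -/
theorem rootSquares_of (hBg : Objectwise (fun M _ => IsGroupLike M) S.tf.ratFnFunctor)
    (toB : ∀ A : S.C, S.biratUnits A →* (S.tf.ratFnFunctor.obj (op A.base))ˣ)
    (hfrac : ∀ {A B : S.C} (s' s'' : A ⟶ B) (h' : S.IsPreStep s') (h'' : S.IsPreStep s'')
      (hb : PreFrobenioid.BaseEquivalent S.F s' s''),
      (toB A (S.fracOf s' s'' h' h'' hb) : S.tf.ratFnFunctor.obj (op A.base)) *
        ModelFrobenioid.unit s'' = ModelFrobenioid.unit s')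
    (hpull : ∀ {A A' : S.C} (φ : A' ⟶ A) (x : S.biratUnits A),
      (toB A' (pullFrac φ x) : S.tf.ratFnFunctor.obj (op A'.base)) =
        pull S.tf.ratFnFunctor (ModelFrobenioid.baseMap φ) (toB A x)) :
    RootSquares S pullFrac := by
  intro B f P N A' α d g BN Q hiso hdeg hg hQn hQd
  -- the data
  haveI : IsIso (ModelFrobenioid.baseMap Q.num) := Q.isPreStep_num.2
  have hQn1 : ModelFrobenioid.degFr Q.num = 1 := Q.isPreStep_num.1
  have hQd1 : ModelFrobenioid.degFr Q.den = 1 := Q.isPreStep_den.1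
  have hPn1 : ModelFrobenioid.degFr P.num = 1 := P.isPreStep_num.1
  have hPd1 : ModelFrobenioid.degFr P.den = 1 := P.isPreStep_den.1
  have hα0 : ModelFrobenioid.div α = 1 := hiso
  have hαN : ModelFrobenioid.degFr α = N := hdeg
  have hbQ : ModelFrobenioid.baseMap Q.den = ModelFrobenioid.baseMap Q.num := Q.base_eq.symm
  have hbP : ModelFrobenioid.baseMap P.den = ModelFrobenioid.baseMap P.num := P.base_eq.symm
  have hbα : ModelFrobenioid.baseMap α = ModelFrobenioid.baseMap d.α₁ := by
    have hc : ModelFrobenioid.baseMap d.α₂ = 𝟙 _ := d.cond_c.1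
    have h := congrArg ModelFrobenioid.baseMap d.fac
    rw [ModelFrobenioid.baseMap_comp, hc, Category.id_comp] at h
    exact h.symm
  obtain ⟨uQ, huQ⟩ := (hBg A'.base).isUnit (ModelFrobenioid.unit Q.num)
  have hQn' : ModelFrobenioid.div Q.num ^ (N : ℕ) =
      pull S.tf.divisorMonoid (ModelFrobenioid.baseMap d.α₁) (ModelFrobenioid.div P.num) := hQn
  have hQd' : ModelFrobenioid.div Q.den ^ (N : ℕ) =
      pull S.tf.divisorMonoid (ModelFrobenioid.baseMap d.α₁) (ModelFrobenioid.div P.den) := hQd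
  -- the composite `ψ := s' ∘ α`
  have hψN : ModelFrobenioid.degFr (α ≫ P.num) = N := by
    rw [ModelFrobenioid.degFr_comp, hPn1, one_mul, hαN]
  have hψdiv : ModelFrobenioid.div (α ≫ P.num) = ModelFrobenioid.div Q.num ^ (N : ℕ) := by
    rw [ModelFrobenioid.div_comp_pull, hα0, one_pow, mul_one, hbα, ← hQn']
  -- `β := (N, Base(s'_N)⁻¹ ∘ Base(s' ∘ α), 0, (Base(s'_N)⁻¹)^*(u_{s'∘α} · u_{s'_N}^{-N}))`
  have hrel := rootSquares_rel S Q.num (α ≫ P.num) hQn1 hψN hψdiv uQ huQ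
  refine ⟨ModelFrobenioid.mkHom BN B N _ _ _ hrel, rfl, rfl, ?_, ?_⟩
  · -- the `s'`-square: by construction
    apply ModelFrobenioid.hom_ext
    · rw [ModelFrobenioid.degFr_comp, ModelFrobenioid.degFr_mkHom, hQn1, mul_one, hψN]
    · rw [ModelFrobenioid.baseMap_comp, ModelFrobenioid.baseMap_mkHom, IsIso.hom_inv_id_assoc]
    · rw [ModelFrobenioid.div_comp_pull, ModelFrobenioid.div_mkHom, ModelFrobenioid.degFr_mkHom, map_one,
        one_mul, hψdiv]
    · rw [ModelFrobenioid.unit_comp_pull, ModelFrobenioid.unit_mkHom, ModelFrobenioid.degFr_mkHom,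
        pull_pull_inv_eq, ← huQ, mul_assoc, ← Units.val_pow_eq_pow_val, ← Units.val_mul, inv_pow,
        inv_mul_cancel, Units.val_one, mul_one]
  · -- the `s''`-square: the fraction condition
    apply ModelFrobenioid.hom_ext
    · rw [ModelFrobenioid.degFr_comp, ModelFrobenioid.degFr_mkHom, hQd1, mul_one,
        ModelFrobenioid.degFr_comp, hPd1, one_mul, hαN]
    · rw [ModelFrobenioid.baseMap_comp, ModelFrobenioid.baseMap_mkHom, hbQ, IsIso.hom_inv_id_assoc,
        ModelFrobenioid.baseMap_comp, ModelFrobenioid.baseMap_comp, hbP]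
    · rw [ModelFrobenioid.div_comp_pull, ModelFrobenioid.div_mkHom, ModelFrobenioid.degFr_mkHom, map_one,
        one_mul, ModelFrobenioid.div_comp_pull, hα0, one_pow, mul_one, hbα, hQd']
    · -- units: `Base(α)^* u_{s''} · u_α = (u_{s'∘α} · u_{s'_N}^{-N}) · u_{s''_N}^N`
      have hfP : (toB S.Aodot f : S.tf.ratFnFunctor.obj (op S.Aodot.base)) * ModelFrobenioid.unit P.den =
          ModelFrobenioid.unit P.num := by
        have h := hfrac P.num P.den P.isPreStep_num P.isPreStep_den P.base_eq
        rwa [P.frac_eq] at h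
      have hfQ : (toB A' g : S.tf.ratFnFunctor.obj (op A'.base)) * ModelFrobenioid.unit Q.den =
          ModelFrobenioid.unit Q.num := by
        have h := hfrac Q.num Q.den Q.isPreStep_num Q.isPreStep_den Q.base_eq
        rwa [Q.frac_eq] at h
      have hgN : (toB A' g : S.tf.ratFnFunctor.obj (op A'.base)) ^ (N : ℕ) =
          pull S.tf.ratFnFunctor (ModelFrobenioid.baseMap α) (toB S.Aodot f : _) := by
        rw [← Units.val_pow_eq_pow_val, ← map_pow, hg, hpull, hbα]
      rw [ModelFrobenioid.unit_comp_pull, ModelFrobenioid.unit_mkHom, ModelFrobenioid.degFr_mkHom, hbQ,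
        pull_pull_inv_eq, ModelFrobenioid.unit_comp_pull, ModelFrobenioid.unit_comp_pull, hPd1, hPn1,
        PNat.one_coe, pow_one, ← hfP, map_mul, ← hgN]
      -- pure commutative-monoid algebra with the unit `uQ = g · u_{s''_N}`
      set x := (toB A' g : S.tf.ratFnFunctor.obj (op A'.base)) with hx
      set y := pull S.tf.ratFnFunctor (ModelFrobenioid.baseMap α) (ModelFrobenioid.unit P.den) with hy
      set z := ModelFrobenioid.unit α with hz
      set q := ModelFrobenioid.unit Q.den with hq
      have huQ' : (uQ : S.tf.ratFnFunctor.obj (op A'.base)) = x * q := by rw [huQ, ← hfQ]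
      calc x ^ (N : ℕ) * y * z * ↑(uQ⁻¹ ^ (N : ℕ)) * q ^ (N : ℕ)
          = y * z * (↑(uQ⁻¹ ^ (N : ℕ)) * (x * q) ^ (N : ℕ)) := by rw [mul_pow]; ac_rfl
        _ = y * z := by
          rw [← huQ', ← Units.val_pow_eq_pow_val, ← Units.val_mul, inv_pow, inv_mul_cancel, Units.val_one,
            mul_one]

end Prop42Sub

/-- **L04 `RootSquares` for the MODEL INSTANCE** `mkOfModel` of the §4 setting (abc-iut-L2-t9:
`O^×(A^birat) := B(A_D)^×`, `s'·(s'')⁻¹ := u_{s'}·u_{s''}⁻¹`, transport `pullFracModel`; dictionary = identity):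
unconditional given `B₀^Λ` group-like (`hBΛ`, Def. 3.6 (i)). [cite: MochizukiEtTh2009, Prop 4.2 p.90] -/
theorem rootSquares_mkOfModel (tf : TemperedFrobenioid T D VD) (hZ : tf.monoidType = MonoidType.Z)
    (hP : ∀ A : Dᵒᵖ, IsPerfect (tf.Φ.carrier A)) (hBΛ : ∀ (Y : D₀ᵒᵖ) (b : T.BΛ.obj Y), IsUnit b)
    (DS : ∀ {A : Dᵒᵖ}, tf.Φ.carrier A → tf.Φ.carrier A → Prop) (IG : D → Prop)
    (gS : ∀ A : D, IG A → (X.Pi →* Aut A)) (gSs : ∀ (A : D) (h : IG A), Function.Surjective (gS A h))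
    (NH : Subgroup (Field.absoluteGaloisGroup K) → tf.category → ℕ+ → Prop)
    (AB : ∀ {A B : tf.category}, Subgroup (Aut A) → (A ⟶ A) → (A ⟶ B) → Prop) (A₀ : tf.category)
    (hA₀ : PreFrobenioid.IsFrobeniusTrivial tf.toElem A₀) (hA₀' : IG A₀.base) :
    Prop42Sub.RootSquares (mkOfModel X tf hZ hP hBΛ DS IG gS gSs NH AB A₀ hA₀ hA₀')
      (fun φ x => tf.pullFracModel φ x) :=
  Prop42Sub.rootSquares_of (mkOfModel X tf hZ hP hBΛ DS IG gS gSs NH AB A₀ hA₀ hA₀')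
    (fun φ x => tf.pullFracModel φ x) (tf.isGroupLike_ratFnFunctor hBΛ)
    (fun A => MonoidHom.id (tf.biratUnitsModel A))
    (fun s' s'' _ _ _ => coe_fracOfModel_mul_unit tf hBΛ s' s'') (fun _ _ => rfl)

end BiKummerSetting

end Literature.AnabelianGeometry.EtaleTheta
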